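import Summits.MatrixMultiplication.OmegaCensus.STPPVosperSlackTwoCheckersT
import Summits.MatrixMultiplication.OmegaCensus.STPPVosperSlackTwoCheckersSound

/-!
# ω-census (abelian STPP census): the PRUNED tiling loop and the pruned table-form case-C checker (kernel tool)

HONEST FRAMING (pub-omega census; verbatim): lottery ticket; floor = certified bounds/negative ranges.
Census STRUCTURE (seat pub-omega-stpp-1 gen 33, 2026-08-28), family (b2).  A branch-pruned variant of `caseCDeadT` (`STPPVosperSlackTwoCheckersT.lean`)
for the expensive case-C rows of the ℤ₅₉ leaves `{(2,2,3),(3,4,2)²}` and `{(2,3,3),(2,3,4),(3,2,3)}` (≈ 1.4–1.5 × 10⁶ tiling nodes unpruned; python mirror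
HOME `pub-omega-stpp-1-g33/code/s2w_mirrorC2.py`): the tiling loop `tilesAllP prune leaf …` enters a child cover `cov ||| m` only if `prune (cov ||| m)`;
for case C the prune is the necessary condition "the `Y°`-candidate mask `⋂_{x∈P}((univ ∖ cov) + x)` still has at least `L` members" — it can only lose
members as the cover grows (`pruneC_antitone`).  Contents: `tilesAllP`, `admissibleP`, `tilesAllP_complete` (the pruned loop reaches every admissible
choice sequence that passes the prune at every prefix), `admissibleP_of_admissible` (for an ANTITONE prune it suffices that the final cover passes),
`pruneC` + `pruneC_antitone`, `caseCDeadTP p c L z Q P h₀ tbl` and its control-flow lemma `caseCLeafT_of_caseCDeadTP` (same leaf `caseCLeafT`, same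
tables as `caseCDeadT`, so the law accepts either row family).  Nothing here is progress on `ω`.

References: H. Cohn, R. Kleinberg, B. Szegedy, C. Umans, FOCS 2005 (arXiv:math/0511460), Def. 5.1; Y. O. Hamidoune, Ø. J. Rødseth, Acta Arith. 92 (2000).
-/

namespace Summit.MatrixMultiplication.OmegaCensus.CubeNB.S2

open Summit.MatrixMultiplication.OmegaCensus.CubeNB.Bits

/-! ## §1 The pruned tiling loop -/

/-- **The pruned tiling loop.**  As `tilesAll`, but a translate `(r, m)` is chosen only if its mask is disjoint from the cover AND `prune (cov ||| m)`
holds. [folklore] -/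
def tilesAllP (prune : ℕ → Bool) (leaf : List ℕ → ℕ → Bool) : ℕ → List (ℕ × ℕ) → List ℕ → ℕ → Bool
  | 0, _, chosen, cov => leaf chosen cov
  | _ + 1, [], _, _ => true
  | k + 1, (r, m) :: rest, chosen, cov =>
    (cond (disjB m cov && prune (cov ||| m)) (tilesAllP prune leaf k rest (chosen ++ [r]) (cov ||| m)) true) &&
      tilesAllP prune leaf (k + 1) rest chosen cov

/-- Sequential admissibility WITH the prune: each mask is disjoint from the cover accumulated before it and the new cover passes `prune`. [folklore] -/
def admissibleP (prune : ℕ → Bool) : ℕ → List (ℕ × ℕ) → Bool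
  | _, [] => true
  | cov, x :: rs => (disjB x.2 cov && prune (cov ||| x.2)) && admissibleP prune (cov ||| x.2) rs

/-- **Completeness of the pruned loop.**  If `rs` is a sublist of `rest`, admissible-with-prune from `cov`, and `leaf` FAILS at the state it leads to, then
`tilesAllP prune leaf rs.length rest chosen cov = false`. [folklore] -/
theorem tilesAllP_complete (prune : ℕ → Bool) (leaf : List ℕ → ℕ → Bool) :
    ∀ (rest rs : List (ℕ × ℕ)) (chosen : List ℕ) (cov : ℕ), rs.Sublist rest → admissibleP prune cov rs = true →
      leaf (chosen ++ rs.map Prod.fst) (rs.foldl (fun c x => c ||| x.2) cov) = false →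
      tilesAllP prune leaf rs.length rest chosen cov = false := by
  intro rest
  induction rest with
  | nil =>
    intro rs chosen cov hsub _ hleaf
    obtain rfl := List.sublist_nil.1 hsub
    simpa [tilesAllP] using hleaf
  | cons y rest ih =>
    intro rs chosen cov hsub hadm hleaf
    obtain ⟨r, m⟩ := y
    cases hsub with
    | cons _ h =>
      rcases rs with _ | ⟨x, rs'⟩
      · simpa [tilesAllP] using hleaf
      · rw [List.length_cons, tilesAllP, Bool.and_eq_false_iff]
        exact Or.inr (ih (x :: rs') chosen cov h hadm hleaf)
    | cons_cons _ h =>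
      rename_i rs₁
      rw [List.length_cons, tilesAllP, Bool.and_eq_false_iff]
      rw [admissibleP, Bool.and_eq_true] at hadm
      obtain ⟨hd, hadm'⟩ := hadm
      refine Or.inl ?_
      rw [show (disjB ((r, m).2) cov && prune (cov ||| (r, m).2)) = (disjB m cov && prune (cov ||| m)) from rfl] at hd
      rw [hd, cond_true]
      refine ih rs₁ (chosen ++ [r]) (cov ||| m) h hadm' ?_
      simpa [List.foldl_cons, List.map_cons, List.append_assoc] using hleaf

/-- **An antitone prune that holds at the final cover holds along the way.**  If `prune` is antitone on masks below `bound` (more bits ⇒ harder to pass),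
`rs` is sequentially admissible from `cov`, the final cover is below `bound` and passes `prune`, then `rs` is admissible-with-prune. [folklore] -/
theorem admissibleP_of_admissible (prune : ℕ → Bool) (bound : ℕ)
    (hanti : ∀ c₁ c₂ : ℕ, c₂ < bound → (∀ i, tb c₁ i = true → tb c₂ i = true) → prune c₂ = true → prune c₁ = true) :
    ∀ (rs : List (ℕ × ℕ)) (cov : ℕ), admissible cov rs = true → rs.foldl (fun c x => c ||| x.2) cov < bound →
      prune (rs.foldl (fun c x => c ||| x.2) cov) = true → admissibleP prune cov rs = true
  | [], _, _, _, _ => rfl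
  | x :: rs, cov, hadm, hlt, hfin => by
    rw [admissible, Bool.and_eq_true] at hadm
    rw [List.foldl_cons] at hlt hfin
    rw [admissibleP, Bool.and_eq_true, Bool.and_eq_true]
    refine ⟨⟨hadm.1, hanti _ _ hlt (fun i hi => ?_) hfin⟩, admissibleP_of_admissible prune bound hanti rs _ hadm.2 hlt hfin⟩
    exact (tb_foldl_lor i rs (cov ||| x.2)).2 (Or.inl hi)

/-! ## §2 The case-C prune and the pruned checker -/

/-- **The case-C prune**: the `Y°`-candidate mask `⋂_{x ∈ P} ((univ ∖ cv) + x)` has at least `L` members. [cite: CohnKleinbergSzegedyUmans2005, Def. 5.1] -/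
def pruneC (p L : ℕ) (P : List ℕ) (cv : ℕ) : Bool :=
  Nat.ble L (popc (List.range p) (P.foldl (fun m x => m &&& rot p (fullMask p ^^^ cv) x) (fullMask p)))

/-- A conjunction fold from `fullMask p` stays below `2^p`. [folklore] -/
theorem foldl_land_rot_lt_two_pow {p M : ℕ} : ∀ (P : List ℕ) (init : ℕ), init < 2 ^ p →
    P.foldl (fun m x => m &&& rot p M x) init < 2 ^ p
  | [], init, h0 => by simpa using h0
  | x :: P, init, h0 => by
    rw [List.foldl_cons]
    exact foldl_land_rot_lt_two_pow P _ (lt_of_le_of_lt Nat.and_le_left h0)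

/-- **The case-C prune is antitone** on covers below `2^p` (for `P ⊆ [0, p)`): enlarging the cover can only shrink the candidate mask.
[cite: CohnKleinbergSzegedyUmans2005, Def. 5.1] -/
theorem pruneC_antitone {p L : ℕ} {P : List ℕ} (hP : ∀ x ∈ P, x < p) (c₁ c₂ : ℕ) (hc₂ : c₂ < 2 ^ p)
    (hsub : ∀ i, tb c₁ i = true → tb c₂ i = true) (h : pruneC p L P c₂ = true) : pruneC p L P c₁ = true := by
  unfold pruneC at h ⊢
  rw [Nat.ble_eq] at h ⊢
  have hfull : fullMask p < 2 ^ p := by rw [fullMask_eq]; have := Nat.one_le_two_pow (n := p); omega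
  have hc₁ : c₁ < 2 ^ p := by
    refine Nat.lt_pow_two_of_testBit _ fun i hi => ?_
    rw [← tb_eq_testBit, Bool.eq_false_iff]
    intro h1
    have h2 := hsub i h1
    rw [tb_eq_false_of_lt hc₂ hi] at h2
    exact Bool.noConfusion h2
  have hM₁ : fullMask p ^^^ c₁ < 2 ^ p := by rw [fullMask_eq] at hfull ⊢; exact Nat.xor_lt_two_pow hfull hc₁
  have hM₂ : fullMask p ^^^ c₂ < 2 ^ p := by rw [fullMask_eq] at hfull ⊢; exact Nat.xor_lt_two_pow hfull hc₂
  refine le_trans h ?_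
  rw [popc_eq_length_filter, popc_eq_length_filter]
  refine (List.monotone_filter_right (List.range p) fun v hv => ?_).length_le
  by_cases hvp : v < p
  · rw [tb_foldl_land_rot hM₂ hP hvp] at hv
    rw [tb_foldl_land_rot hM₁ hP hvp]
    intro x hx
    have hlt : (v + p - x) % p < p := Nat.mod_lt _ (by omega)
    have h2 := hv x hx
    rw [tb_compl hlt] at h2 ⊢
    rw [Bool.not_eq_true'] at h2 ⊢
    rw [Bool.eq_false_iff] at h2 ⊢
    exact fun h1 => h2 (hsub _ h1)
  · rw [tb_eq_false_of_lt (foldl_land_rot_lt_two_pow P _ hfull) (by omega)] at hv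
    exact Bool.noConfusion hv

/-- **Case C is dead for the shapes `(Q, P)` and the hole `h₀`, table form, PRUNED loop**: as `caseCDeadT`, with `tilesAllP (pruneC p L P)`.
[cite: CohnKleinbergSzegedyUmans2005, Def. 5.1] [cite: HamidouneRodseth2000, main theorem (§1, p. 252)] -/
def caseCDeadTP (p c L z : ℕ) (Q P : List ℕ) (h₀ : ℕ) (tbl : List (List ℕ × List ℕ)) : Bool :=
  let patt := pattPQ p P Q
  !(decide patt.Nodup) ||
    (let Zo := (List.range (z + 1)).filter fun t => !(Nat.beq t h₀)
     let tM := Q.foldl (fun m q => m ||| rot p (maskOf Zo) (p - q)) 0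
     !(Nat.beq (popc (List.range p) tM) (Q.length + z)) || tilesAllP (pruneC p L P) (caseCLeafT p L P Zo tbl) c (transMasks p patt) [] tM)

/-- **Pruned case C is exhaustive**: if `caseCDeadTP … = true`, the pattern is duplicate-free, `P ⊆ [0, p)`, and the mask of `T = −Q + Z°` has `|Q| + z`
members, then for every sequentially admissible choice `rs` of `c` translates from the cover `T` whose FINAL cover is below `2^p` and passes the prune,
the leaf holds at the resulting tiling. [cite: CohnKleinbergSzegedyUmans2005, Def. 5.1] -/
theorem caseCLeafT_of_caseCDeadTP {p c L z : ℕ} {Q P : List ℕ} {h₀ : ℕ} {tbl : List (List ℕ × List ℕ)}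
    (h : caseCDeadTP p c L z Q P h₀ tbl = true) (hpatt : (pattPQ p P Q).Nodup) (hP : ∀ x ∈ P, x < p)
    (hT : popc (List.range p)
      (Q.foldl (fun m q => m ||| rot p (maskOf ((List.range (z + 1)).filter fun t => !(Nat.beq t h₀))) (p - q)) 0) = Q.length + z)
    (rs : List (ℕ × ℕ)) (hsub : rs.Sublist (transMasks p (pattPQ p P Q))) (hlen : rs.length = c)
    (hadm : admissible (Q.foldl (fun m q => m ||| rot p (maskOf ((List.range (z + 1)).filter fun t => !(Nat.beq t h₀))) (p - q)) 0) rs = true)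
    (hlt : rs.foldl (fun cv x => cv ||| x.2)
      (Q.foldl (fun m q => m ||| rot p (maskOf ((List.range (z + 1)).filter fun t => !(Nat.beq t h₀))) (p - q)) 0) < 2 ^ p)
    (hfin : pruneC p L P (rs.foldl (fun cv x => cv ||| x.2)
      (Q.foldl (fun m q => m ||| rot p (maskOf ((List.range (z + 1)).filter fun t => !(Nat.beq t h₀))) (p - q)) 0)) = true) :
    caseCLeafT p L P ((List.range (z + 1)).filter fun t => !(Nat.beq t h₀)) tbl (rs.map Prod.fst)
      (rs.foldl (fun cv x => cv ||| x.2)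
        (Q.foldl (fun m q => m ||| rot p (maskOf ((List.range (z + 1)).filter fun t => !(Nat.beq t h₀))) (p - q)) 0)) = true := by
  unfold caseCDeadTP at h
  simp only [hpatt, decide_true, Bool.not_true, Bool.false_or, hT, Nat.beq_refl] at h
  have hadmP := admissibleP_of_admissible (pruneC p L P) (2 ^ p) (fun c₁ c₂ hc₂ hs hc => pruneC_antitone hP c₁ c₂ hc₂ hs hc)
    rs _ hadm hlt hfin
  by_contra hleaf
  rw [Bool.not_eq_true] at hleaf
  have key := tilesAllP_complete (pruneC p L P) (caseCLeafT p L P ((List.range (z + 1)).filter fun t => !(Nat.beq t h₀)) tbl) _ rs [] _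
    hsub hadmP (by simpa using hleaf)
  rw [hlen, h] at key
  exact Bool.noConfusion key

end Summit.MatrixMultiplication.OmegaCensus.CubeNB.S2
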